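import Literature.RingTheory.NoetherNormalization.GenericLinearForms
import HarnessLib

/-!
# Generic linear forms are algebraically independent — version with extra free variables

`Literature/RingTheory/NoetherNormalization/GenericLinearFormsExtra.lean` — proofs only,
sequel of `GenericLinearForms.lean`. The same theorem with additional rows of independent
variables carrying no form:

* `algebraicIndependent_sumElim_genericLinearForms'` — fields `K ⊆ F ⊆ Ω`, `K` infinite,
  `y : ι → F` with `s ≤ trdeg_K K[y]`, `u = (u_{ρk})_{ρ ∈ Fin s ⊕ E, k ∈ ι}` algebraically
  independent over `F`; then all the `u_{ρk}` together with the `s` forms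
  `wᵢ = ∑ₖ yₖ u_{ik}` (`i ∈ Fin s`) are algebraically independent over `K`.

This is the form in which the theorem enters the computation of the dimension of the variety of
the Chow form of a prime ideal (Nesterenko, LNM 1752 Ch. 3 Prop. 4.4, file
`Literature/NumberTheory/Transcendental/NesterenkoChowFormPrime.lean`): with `r` blocks of
variables `u₁, …, u_r` one has `r − 1 = dim` independent forms, while the variables of all `r`
blocks count. The proof repeats the specialisation argument of `GenericLinearForms.lean`
(`aeval_genericSpec_eq_zero'`: the variables of the rows in `E` are simply kept as variables,
and ride along with the free variables of the density lemma
`eq_zero_of_forall_algebraicIndependent_aeval_eq_zero`).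

## References

* B. L. van der Waerden, *Einführung in die algebraische Geometrie*, Springer 1939/1973, §§29–31.
* W. V. D. Hodge, D. Pedoe, *Methods of Algebraic Geometry*, vol. II, CUP 1952, Ch. X §6.
-/

noncomputable section

open MvPolynomial Cardinal

universe u

namespace Literature.RingTheory.NoetherNormalization

variable {K : Type*} [Field K]

section Spec

variable {F Ω : Type*} [Field F] [Field Ω] [Algebra K F] [Algebra F Ω] [Algebra K Ω]
  [IsScalarTower K F Ω] {ι : Type*} [Fintype ι] {E : Type*} {s : ℕ}

/-- **Specialisation, with extra variables.** As `aeval_genericSpec_eq_zero`, for a family `u`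
indexed by the rows `Fin s ⊕ E`, the forms being attached to the rows in `Fin s` only: the
variables of the rows in `E` are kept as variables. [folklore] -/
theorem aeval_genericSpec_eq_zero' (y : ι → F) (u : (Fin s ⊕ E) × ι → Ω)
    (hu : AlgebraicIndependent F u)
    {P : MvPolynomial (((Fin s ⊕ E) × ι) ⊕ Fin s) K}
    (hP : aeval (Sum.elim u (fun i => ∑ k, algebraMap F Ω (y k) * u (Sum.inl i, k))) P = 0)
    (c : Fin s × ι → K)
    (hc : AlgebraicIndependent K (fun i : Fin s => ∑ k, algebraMap K F (c (i, k)) * y k)) :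
    aeval (Sum.elim (fun p => C (c p)) X :
        (Fin s × ι) ⊕ ((E × ι) ⊕ (Fin s ⊕ Fin s)) → MvPolynomial ((E × ι) ⊕ (Fin s ⊕ Fin s)) K)
      (aeval (Sum.elim
          (fun p : (Fin s ⊕ E) × ι => Sum.elim
            (fun i : Fin s => (X (Sum.inl (i, p.2)) * X (Sum.inr (Sum.inr (Sum.inl i))) :
              MvPolynomial ((Fin s × ι) ⊕ ((E × ι) ⊕ (Fin s ⊕ Fin s))) K))
            (fun e : E => X (Sum.inr (Sum.inl (e, p.2)))) p.1)
          (fun i : Fin s => X (Sum.inr (Sum.inr (Sum.inl i))) * X (Sum.inr (Sum.inr (Sum.inr i)))) :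
        ((Fin s ⊕ E) × ι) ⊕ Fin s →
          MvPolynomial ((Fin s × ι) ⊕ ((E × ι) ⊕ (Fin s ⊕ Fin s))) K) P) = 0 := by
  -- `σ`: substitute the linear forms for the `Wᵢ`, over `F`
  set σ : MvPolynomial (((Fin s ⊕ E) × ι) ⊕ Fin s) K →ₐ[K] MvPolynomial ((Fin s ⊕ E) × ι) F :=
    aeval (Sum.elim X (fun i => ∑ k, C (y k) * X (Sum.inl i, k))) with hσ
  have hσP : σ P = 0 := by
    have hcomp : ((aeval u).restrictScalars K).comp σ =
        aeval (Sum.elim u (fun i => ∑ k, algebraMap F Ω (y k) * u (Sum.inl i, k))) := by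
      refine MvPolynomial.algHom_ext fun v => ?_
      rcases v with p | i
      · simp [σ]
      · simp [σ, map_sum]
    have h1 : aeval u (σ P) = 0 := by
      have := congrArg (fun f => f P) hcomp
      simpa [hP] using this
    have hinj : Function.Injective (aeval u : MvPolynomial ((Fin s ⊕ E) × ι) F →ₐ[F] Ω) := hu
    exact (injective_iff_map_eq_zero _).1 hinj (σ P) h1
  -- the specialisation maps
  set η : MvPolynomial (((Fin s ⊕ E) × ι) ⊕ Fin s) K →ₐ[K]
      MvPolynomial ((Fin s × ι) ⊕ ((E × ι) ⊕ (Fin s ⊕ Fin s))) K :=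
    aeval (Sum.elim
      (fun p : (Fin s ⊕ E) × ι => Sum.elim
        (fun i : Fin s => (X (Sum.inl (i, p.2)) * X (Sum.inr (Sum.inr (Sum.inl i))) :
          MvPolynomial ((Fin s × ι) ⊕ ((E × ι) ⊕ (Fin s ⊕ Fin s))) K))
        (fun e : E => X (Sum.inr (Sum.inl (e, p.2)))) p.1)
      (fun i : Fin s => X (Sum.inr (Sum.inr (Sum.inl i))) * X (Sum.inr (Sum.inr (Sum.inr i)))))
    with hη
  set ev : MvPolynomial ((Fin s × ι) ⊕ ((E × ι) ⊕ (Fin s ⊕ Fin s))) K →ₐ[K]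
      MvPolynomial ((E × ι) ⊕ (Fin s ⊕ Fin s)) K :=
    aeval (Sum.elim (fun p => C (c p)) X) with hev
  set z : Fin s → F := fun i => ∑ k, algebraMap K F (c (i, k)) * y k with hz
  set ρ : MvPolynomial ((E × ι) ⊕ (Fin s ⊕ Fin s)) K →ₐ[K] MvPolynomial ((E × ι) ⊕ Fin s) F :=
    aeval (Sum.elim (fun q => X (Sum.inl q)) (Sum.elim (fun i => X (Sum.inr i)) (fun i => C (z i))))
    with hρ
  set τ : MvPolynomial ((Fin s ⊕ E) × ι) F →ₐ[F] MvPolynomial ((E × ι) ⊕ Fin s) F :=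
    aeval (fun p : (Fin s ⊕ E) × ι => Sum.elim
      (fun i : Fin s => C (algebraMap K F (c (i, p.2))) * X (Sum.inr i))
      (fun e : E => X (Sum.inl (e, p.2))) p.1) with hτ
  have hcomp : (ρ.comp ev).comp η = (τ.restrictScalars K).comp σ := by
    refine MvPolynomial.algHom_ext fun v => ?_
    rcases v with ⟨ρ' | e, k⟩ | i
    · simp [η, ev, ρ, τ, σ]
    · simp [η, ev, ρ, τ, σ]
    · simp only [η, ev, ρ, τ, σ, z, AlgHom.coe_comp, Function.comp_apply, aeval_X, Sum.elim_inr,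
        map_mul, Sum.elim_inl, map_sum, AlgHom.coe_restrictScalars', Finset.mul_sum]
      refine Finset.sum_congr rfl fun k _ => ?_
      simp only [aeval_C, algebraMap_eq]
      ring
  have hρinj : Function.Injective ρ := by
    have hind : AlgebraicIndependent K (Sum.elim (X : (E × ι) ⊕ Fin s → MvPolynomial _ F)
        (algebraMap F (MvPolynomial ((E × ι) ⊕ Fin s) F) ∘ z)) :=
      hc.sumElim_comp (MvPolynomial.algebraicIndependent_X _ F)
    have hind' := (algebraicIndependent_equiv' (R := K) (Equiv.sumAssoc (E × ι) (Fin s) (Fin s)).symm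
      (f := Sum.elim (X : (E × ι) ⊕ Fin s → MvPolynomial _ F)
        (algebraMap F (MvPolynomial ((E × ι) ⊕ Fin s) F) ∘ z))
      (g := Sum.elim (fun q => X (Sum.inl q))
        (Sum.elim (fun i => X (Sum.inr i)) (fun i => C (z i))))
      (by funext v; rcases v with q | (i | i) <;> rfl)).2 hind
    have heq : (aeval (Sum.elim (fun q => X (Sum.inl q))
        (Sum.elim (fun i => X (Sum.inr i)) (fun i => C (z i)))) :
          _ →ₐ[K] MvPolynomial ((E × ι) ⊕ Fin s) F) = ρ := rfl
    have : Function.Injective (aeval (Sum.elim (fun q => X (Sum.inl q))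
        (Sum.elim (fun i => X (Sum.inr i)) (fun i => C (z i)))) :
          _ →ₐ[K] MvPolynomial ((E × ι) ⊕ Fin s) F) := hind'
    rwa [heq] at this
  show ev (η P) = 0
  apply hρinj
  have := congrArg (fun f => f P) hcomp
  simp only [AlgHom.comp_apply, AlgHom.coe_restrictScalars'] at this
  rw [map_zero, this, hσP, map_zero]

end Spec

section Main

variable [Infinite K] {F Ω : Type*} [Field F] [Field Ω] [Algebra K F] [Algebra F Ω] [Algebra K Ω]
  [IsScalarTower K F Ω] {s : ℕ}

/-- Extra-variables version of `algebraicIndependent_sumElim_genericLinearForms`, index types in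
`Type`. [folklore] -/
theorem algebraicIndependent_sumElim_genericLinearForms₀' {ι E : Type} [Fintype ι]
    (y : ι → F) (u : (Fin s ⊕ E) × ι → Ω) (hu : AlgebraicIndependent F u)
    (hs : (s : Cardinal) ≤ Algebra.trdeg K (Algebra.adjoin K (Set.range y))) :
    AlgebraicIndependent K
      (Sum.elim u (fun i : Fin s => ∑ k, algebraMap F Ω (y k) * u (Sum.inl i, k))) := by
  classical
  rw [algebraicIndependent_iff_injective_aeval, injective_iff_map_eq_zero]
  intro P hP
  set ηv : ((Fin s ⊕ E) × ι) ⊕ Fin s →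
      MvPolynomial ((Fin s × ι) ⊕ ((E × ι) ⊕ (Fin s ⊕ Fin s))) K :=
    Sum.elim
      (fun p : (Fin s ⊕ E) × ι => Sum.elim
        (fun i : Fin s => (X (Sum.inl (i, p.2)) * X (Sum.inr (Sum.inr (Sum.inl i))) :
          MvPolynomial ((Fin s × ι) ⊕ ((E × ι) ⊕ (Fin s ⊕ Fin s))) K))
        (fun e : E => X (Sum.inr (Sum.inl (e, p.2)))) p.1)
      (fun i : Fin s => X (Sum.inr (Sum.inr (Sum.inl i))) * X (Sum.inr (Sum.inr (Sum.inr i))))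
    with hηv
  set θv : (Fin s × ι) ⊕ ((E × ι) ⊕ (Fin s ⊕ Fin s)) →
      MvPolynomial (((Fin s ⊕ E) × ι) ⊕ Fin s) K :=
    Sum.elim (fun p => X (Sum.inl (Sum.inl p.1, p.2)))
      (Sum.elim (fun q => X (Sum.inl (Sum.inr q.1, q.2)))
        (Sum.elim (fun _ => 1) (fun i => X (Sum.inr i)))) with hθv
  -- the universal specialisation `η P` of `P` vanishes, by density and specialisation
  have hη : aeval ηv P = 0 :=
    eq_zero_of_forall_algebraicIndependent_aeval_eq_zero y s hs _ fun c hc =>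
      aeval_genericSpec_eq_zero' y u hu hP c hc
  -- and `η` has a left inverse
  have hcomp : (aeval θv).comp (aeval ηv) = AlgHom.id K _ := by
    refine MvPolynomial.algHom_ext fun v => ?_
    rcases v with ⟨i | e, k⟩ | i <;> simp [ηv, θv]
  have := congrArg (fun f => f P) hcomp
  simp only [AlgHom.comp_apply, AlgHom.id_apply] at this
  rw [hη, map_zero] at this
  exact this.symm

/-- **Generic linear forms are algebraically independent, with extra free variables.** As
`algebraicIndependent_sumElim_genericLinearForms` (fields `K ⊆ F ⊆ Ω`, `K` infinite,
`y : ι → F` with `s ≤ trdeg_K K[y]`), for a family `u = (u_{ρk})` algebraically independent over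
`F` whose rows are indexed by `Fin s ⊕ E`: the `s` forms `wᵢ = ∑ₖ yₖ u_{ik}` attached to the rows
`i ∈ Fin s`, together with ALL the `u_{ρk}` (including the rows `ρ ∈ E` carrying no form), are
algebraically independent over `K`. [folklore] -/
theorem algebraicIndependent_sumElim_genericLinearForms' {ι E : Type*} [Fintype ι] [Fintype E]
    (y : ι → F) (u : (Fin s ⊕ E) × ι → Ω) (hu : AlgebraicIndependent F u)
    (hs : (s : Cardinal) ≤ Algebra.trdeg K (Algebra.adjoin K (Set.range y))) :
    AlgebraicIndependent K
      (Sum.elim u (fun i : Fin s => ∑ k, algebraMap F Ω (y k) * u (Sum.inl i, k))) := by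
  classical
  -- transport to index types `Fin (card ι)`, `Fin (card E)`
  set e := Fintype.equivFin ι with he
  set d := Fintype.equivFin E with hd
  set y' : Fin (Fintype.card ι) → F := y ∘ e.symm with hy'
  set re : (Fin s ⊕ Fin (Fintype.card E)) × Fin (Fintype.card ι) → (Fin s ⊕ E) × ι :=
    fun p => (Sum.map id d.symm p.1, e.symm p.2) with hre
  have hre_inj : Function.Injective re := by
    rintro ⟨a, b⟩ ⟨a', b'⟩ h
    simp only [re, Prod.mk.injEq] at h
    obtain ⟨h1, h2⟩ := h
    have h2' := e.symm.injective h2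
    subst h2'
    rcases a with i | x <;> rcases a' with i' | x'
    · simp only [Sum.map_inl, id_eq, Sum.inl.injEq] at h1; subst h1; rfl
    · simp at h1
    · simp at h1
    · simp only [Sum.map_inr, Sum.inr.injEq] at h1
      rw [d.symm.injective h1]
  set u' : (Fin s ⊕ Fin (Fintype.card E)) × Fin (Fintype.card ι) → Ω := u ∘ re with hu'
  have hrange : Set.range y' = Set.range y := by
    rw [hy', Set.range_comp, Equiv.range_eq_univ, Set.image_univ]
  have hu'' : AlgebraicIndependent F u' := hu.comp re hre_inj
  have h := algebraicIndependent_sumElim_genericLinearForms₀' (K := K) y' u' hu''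
    (by rwa [hrange])
  have hw : (fun i : Fin s => ∑ k, algebraMap F Ω (y' k) * u' (Sum.inl i, k)) =
      fun i => ∑ k, algebraMap F Ω (y k) * u (Sum.inl i, k) := by
    funext i
    exact Equiv.sum_comp e.symm (fun k => algebraMap F Ω (y k) * u (Sum.inl i, k))
  rw [hw] at h
  -- `Sum.elim u' w = Sum.elim u w ∘ (re ⊕ id)`, and `re ⊕ id` is a bijection
  set rr : ((Fin s ⊕ Fin (Fintype.card E)) × Fin (Fintype.card ι)) ⊕ Fin s ≃ ((Fin s ⊕ E) × ι) ⊕ Fin s :=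
    Equiv.sumCongr ((Equiv.prodCongr (Equiv.sumCongr (Equiv.refl (Fin s)) d.symm) e.symm))
      (Equiv.refl (Fin s)) with hrr
  have key : Sum.elim u' (fun i : Fin s => ∑ k, algebraMap F Ω (y k) * u (Sum.inl i, k)) =
      Sum.elim u (fun i : Fin s => ∑ k, algebraMap F Ω (y k) * u (Sum.inl i, k)) ∘ rr := by
    funext v
    rcases v with ⟨a, b⟩ | i
    · rcases a with i | x <;> rfl
    · rfl
  rw [key] at h
  exact (algebraicIndependent_equiv _).mp h

end Main

end Literature.RingTheory.NoetherNormalization
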